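import Mathlib
import Literature.MathematicalPhysics.QuantumFieldTheory.MagnenRivasseauSeneor1993.MRS93HomotheticCovariantA27
import HarnessLib

/-!
# Magnen–Rivasseau–Sénéor, *Construction of YM₄ with an infrared cutoff* (CMP 155, 1993), App. 1 p.383: the transfer of the
# stability determinant from the Feynman gauge to the homothetic gauge — «the determinant of (−Δ_B^{homothetic})(−Δ^{homothetic})⁻¹
# is bounded away from 0 up to a constant factor by the bound (A.6)» — PROVED (kernel) for the CROSS-ordered operator, on the whole
# unit momentum sphere, for every constant two-component background, every cutoff value `0 ≤ κ ≤ 1` and every `0 < ζ ≤ 1`: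
# `det BF_cross ≥ ζ⁹ · det BF|_{ζ=1}`

statement-level skeleton of published theorems with citation tags; proofs where landed; nothing here is a claim about the
Yang–Mills mass gap, about continuum YM₄ on T⁴, or about the Clay problem

**Citation header (reproduction of PUBLISHED work).** J. Magnen, V. Rivasseau, R. Sénéor, *Construction of YM₄ with an infrared
cutoff*, Commun. Math. Phys. **155** (1993) 325–383 [MagnenRivasseauSeneor1993], §VI (VI.6)–(VI.10) pp.369–370, (VI.14) p.372, Lemma VI.2
(VI.20a/b) p.374; App. 1 (A.6) p.379, (A.27) p.382, p.382 tl.26–31 and p.383 tl.1–7 (held scan `paper:magnen1993-cmp155-mrs-ym4-infrared-cutoff`;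
page images `run/shared/lean/pub/pub-balaban-gaps/pub-balaban-gaps-mrs-lit-2/g4/renders/p58_crop_r4300-5700_s2.png`,
`p59_crop_r250-2300_s2.png`). Cell pub-balaban-gaps (YM blitz, track G3), seat mrs-lit-2 (gen 5; v1.1 §6 same gen); companion record
`run/shared/lean/pub/pub-balaban-gaps/g3/MRS-AS-PRINTED-estimates.md` §3 findings (l), (m); exact-arithmetic screen (ℚ(i), 602 points,
not a proof) `run/shared/lean/pub/pub-balaban-gaps/pub-balaban-gaps-mrs-lit-2/g5/transfer_check.py` (sha16 d8d27ed2d44dd647, output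
4c780c78d6c8f189). Imports `MRS93HomotheticCovariantA27.lean` (file 15: the cross-ordered blocks `HomotheticA27.BFm1Cross`, the forms
`formLap`/`crossM`/`formCross` and (A.27) for the cross form `A27_crossForm_matrix`; through it file 10 `BosonTrace.PsqUnit`/`KFPUnit`/`nvec`
and file 9 `FeynmanGauge.Pmat` (VI.6)).

**What the paper prints (verbatim, from the page images).** p.382 tl.26–31 [PDF 58]: «We want also to derive a bound showing the strict
positivity of −Δ_B^{homothetic} in a constant field B, unless all the components of B are in the same direction in su(2) space, and p is
then exactly aligned with the corresponding (unique) vector λB. For this we use the fact that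
  δ_μν D² − 10/13 ∇_μ∇_ν ≥ 3/13 D²;   δ_μν p² − 10/13 p_μp_ν ≤ 23/13 p²   (A.27)»
p.383 tl.1–7 [PDF 59]: «in order to show that the normalized operator (−Δ_B^{homothetic})(−Δ^{homothetic})⁻¹ is bounded up to a factor
(3/23)¹² exactly by the same bound as in the Feynman case of ordinary Laplacians. In that case we can use the explicit computations above
to establish the necessary bounds. In particular this proves that the determinant of (−Δ_B^{homothetic})(−Δ^{homothetic})⁻¹ is bounded
away from 0 up to a constant factor by the bound (A.6).» (VI.9) p.370 [PDF 46]: «BF = δ_μν + ψ[(P²δ_μσ − (1 − ζ)P_μP_σ)(δ_σν +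
(ζ⁻¹ − 1)p_σp_ν/p²) − p²δ_μν]»; (VI.14) p.372 and Lemma VI.2 p.374 integrate «− (1/2) ln(1 + βP(β, κ, t, cos θ, sin φ, ζ, 1/ζ))» with
`1 + βP = det BF`; p.372 tl.34–36: «In the case of the Feynman gauge ζ = 1, this determinant simplifies into a three by three determinant
to the fourth power»; p.339 tl.34: «ζ is the number close to 3/13 defining the homothetic gauge».

**The dictionary (unit momentum sphere, as in files 10/15/17).** `p_μ → n_μ`, `Σn_μ² = 1`; `ψ = κ/p² = κ ∈ [0,1]`; background `(x, y)`
(`β = ψx²`, `y = tx`); `P_μ = FeynmanGauge.Pmat n₀ n₁ n₂ n₃ x y μ` (VI.6); `w` stands for `ζ⁻¹` (`ζw = 1` imposed where needed). The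
CROSS-ordered `BF` (file 15 `BFm1Cross`, the form p.357 tl.10 and (A.27) describe; the literal index order of the display (VI.9) is the
DIV form, for which (A.27) FAILS — file 15 `A27_divForm_counterexample` — and `det BF < 0` at large background for every `ζ < 1/2` —
file 17 `DetSign.det_BFe0_homothetic = −50311328125/3` at `ζ = 3/13`):
  `BF_cross = 1 + ψ[A·g − 1]`,  `A_{μν} = P²δ_{μν} − (1 − ζ)P_νP_μ` (= −Δ_B^{homothetic}, cross form),
  `g_{σν} = δ_{σν} + (w − 1)n_σn_ν` (= p²(−Δ^{homothetic})⁻¹),  so  `BF_cross = [(1 − ψ)g⁻¹ + ψA]·g =: H·g`,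
and at `ζ = w = 1`: `BF|_{ζ=1} = δ_{μν}((1 − ψ) + ψP²) = δ_{μν}(1 + ψU)` ((VI.10); `M3`, `M3_eq_onePlusPsiU` = file 9's `onePlusPsiU`,
whose determinant is the (A.6)/(VI.15) cubic, `FeynmanGauge.det_onePlusPsiU`).

**What this file PROVES (kernel; zero `sorry`, zero named facts — numbers, not adjectives).**
* §0 [folklore] `det_le_det_of_posDef_of_sub_posSemidef`: for complex Hermitian `W ≻ 0`, `W′ − W ⪰ 0 ⟹ det W ≤ det W′` (Mathlib has
  `PosSemidef.det_nonneg`/`PosDef.det_pos` but not this monotonicity; the tree's `MinkowskiDet.det_le_det_add_of_posSemidef` is real-only).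
* §1–§3 the objects and the factorisation: `blkBF_eq` (file 15's blocks `= (1 − ψ)·1 + ψ·A·g` on the sphere — the link of record),
  `Gsinv_mul_Gs` (`g⁻¹ = δ − (1 − ζ)n_σn_ν`), `det_Gs` (`det g = w`), `BF12Cross_eq_mul`, **`det_BF12Cross`: `det BF_cross = det H · w³`**.
* §4 **`posSemidef_sub`: `H − ζ·BF|_{ζ=1} ⪰ 0`** (12 × 12 complex Hermitian; `ζ ≤ 1`, `0 ≤ ψ ≤ 1`): its quadratic form is
  `(1 − ψ)(1 − ζ)[Σ‖a_μ‖² − ‖Σn_μa_μ‖²] + ψ[formCross − ζ·formLap]`, nonnegative by Cauchy–Schwarz (`Xout_re_le`) and by (A.27) for the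
  cross form (file 15 `A27_crossForm_matrix`: `ζ·Σ‖P_σa_μ‖² ≤ Σ‖P_σa_μ‖² − (1 − ζ)Re Σ⟨P_νa_μ, P_μa_ν⟩`).
* §5 **`det_transfer`: `ζ⁹ · det((1 − ψ) + ψP²)⁴ ≤ det BF_cross`** for `0 < ζ ≤ 1`, `ζw = 1`, `0 ≤ ψ ≤ 1`, `Σn_μ² = 1`, all `x, y`
  (so `det BF_cross ≥ 0`, `det_BF12Cross_nonneg`; `> 0` off the zero set of `det(1 + ψU)`, cf. (A.28)); with the PRINTED constant at the
  homothetic point, **`det_transfer_printed`: `(3/23)¹² · det BF|_{ζ=1} ≤ det BF_cross|_{ζ=3/13}`** (as `(3/13)⁹ ≥ (3/23)¹²`); and the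
  logarithmic shape integrated in (VI.14)/Lemma VI.2, `neg_half_log_det_transfer`:
  `−½ ln det BF_cross ≤ −½ ln det BF|_{ζ=1} + (9/2) ln(1/ζ)` wherever `det BF|_{ζ=1} > 0`.
  (The exponent: `H ⪰ ζ·BF|_{ζ=1}` gives `ζ¹²`, and `det g = w³ = ζ⁻³`.)

* §6 (v1.1) `BFm1Cross_sub_BFm1` (every block: `BFm1Cross_{μν} − BFm1_{μν} = ψ(1 − ζ)([P_μ, P_ν] + (w − 1)n_ν[P_μ, K_FP])`,
  generalising file 15's `BFm1Cross_sub_BFm1_11`), `trace_BFm1Cross_eq` (the difference is traceless, every block), `BFm1Cross_sub_BFm1_homogeneous`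
  (it is homogeneous of degree 2 in `(x, y) ∝ √β`): the two orderings share their degree-0 and degree-1 parts and differ at order β by traceless
  commutators — so the first order in β of `−½ln det BF`, «(VI.17)» (file 10 `bosonFirstOrder_VI17`, `lnDetFirstOrder = Σtr R²_μμ + ½Σtr(R¹R¹)`),
  is the same for the cross ordering (the small-β input (H1) of Lemma VI.2 at ζ = 3/13 thus starts from the PROVED (VI.17)–(VI.19); its
  uniform `O(β²)` remainder is what remains, file 19).

**What is NOT claimed.** Which ordering of the `(1 − ζ)`-blocks the authors intend (the seat does not adjudicate; for the literal
ordering the printed sentence is FALSE on an explicit family, file 17); Lemma VI.2 at `ζ = 3/13`: the LARGE-β branch (VI.20a) for the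
cross form follows pointwise from `neg_half_log_det_transfer` and the ζ = 1 theorem `FeynmanGauge.lemmaVI2_feynmanGauge` (file 9) up to
the angular-average bookkeeping, which is NOT done here; the SMALL-β branch (VI.20b) needs the uniform `O(β²)` control of `ln det BF_cross`
((VI.17) gives the first order for every ζ, file 10), NOT done here; nothing about non-constant backgrounds, the cluster expansion, the
infrared cutoff (fixed, never lifted), T⁴, or Bałaban's papers.
-/

noncomputable section

open scoped ComplexOrder MatrixOrder Kronecker
open Complex Matrix Finset

namespace Literature.MathematicalPhysics.QuantumFieldTheory.MagnenRivasseauSeneor1993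

namespace DetTransfer

open FeynmanGauge BosonTrace HomotheticA27

/-! ## §0 Folklore: the determinant is monotone in the Loewner order on the positive definite cone -/

section Folklore

variable {ι : Type*} [Fintype ι] [DecidableEq ι]

/-- For a Hermitian `M` with `M − 1 ⪰ 0` every eigenvalue of `M` is `≥ 1` (the Rayleigh quotient at a unit eigenvector; Horn–Johnson
Cor. 7.7.4 (c) «If A ⪰ B, then λ_i(A) ≥ λ_i(B)» at `B = I`). [cite: HornJohnson2013, Cor. 7.7.4 (c) (p0606)] -/
theorem one_le_eigenvalues_of_sub_one_posSemidef {M : Matrix ι ι ℂ} (hM : M.IsHermitian)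
    (h1 : (M - 1).PosSemidef) (i : ι) : 1 ≤ hM.eigenvalues i := by
  have hvv : star ⇑(hM.eigenvectorBasis i) ⬝ᵥ ⇑(hM.eigenvectorBasis i) = 1 := by
    rw [dotProduct_comm, ← EuclideanSpace.inner_eq_star_dotProduct, inner_self_eq_norm_sq_to_K,
      hM.eigenvectorBasis.orthonormal.1 i]
    simp
  have hq : (0 : ℂ) ≤ star ⇑(hM.eigenvectorBasis i) ⬝ᵥ ((M - 1) *ᵥ ⇑(hM.eigenvectorBasis i)) :=
    h1.dotProduct_mulVec_nonneg _
  rw [sub_mulVec, one_mulVec, dotProduct_sub, hvv, sub_nonneg] at hq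
  have hre := (Complex.le_def.1 hq).1
  rw [Complex.one_re] at hre
  rw [hM.eigenvalues_eq i]
  simpa using hre

/-- `1 ≤ det M` for `M − 1 ⪰ 0` (product of eigenvalues `≥ 1`; Horn–Johnson Cor. 7.7.4 (e) at `B = I`). [cite: HornJohnson2013, Cor. 7.7.4 (e) (p0606)] -/
theorem one_le_det_of_sub_one_posSemidef {M : Matrix ι ι ℂ} (h1 : (M - 1).PosSemidef) : (1 : ℂ) ≤ M.det := by
  have hM : M.IsHermitian := by
    have := h1.1.add (isHermitian_one : (1 : Matrix ι ι ℂ).IsHermitian)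
    simpa using this
  have h : ∀ i, (1 : ℝ) ≤ hM.eigenvalues i := one_le_eigenvalues_of_sub_one_posSemidef hM h1
  have hprod : (1 : ℝ) ≤ ∏ i, hM.eigenvalues i := by
    calc (1 : ℝ) = ∏ _i : ι, (1 : ℝ) := by simp
      _ ≤ ∏ i, hM.eigenvalues i := Finset.prod_le_prod (fun _ _ => zero_le_one) (fun i _ => h i)
  have hdet : M.det = ((∏ i, hM.eigenvalues i : ℝ) : ℂ) := by
    rw [hM.det_eq_prod_eigenvalues]
    push_cast
    rfl
  rw [hdet, ← Complex.ofReal_one, Complex.real_le_real]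
  exact hprod

/-- **Monotonicity of `det` in the Loewner order on the positive definite cone** (complex Hermitian matrices):
`W ≻ 0`, `W′ − W ⪰ 0 ⟹ det W ≤ det W′` (in the star order of `ℂ`: both determinants are real). Proof: `W = AᴴA`,
`M = A⁻ᴴ W′ A⁻¹` has `M − 1 = A⁻ᴴ(W′ − W)A⁻¹ ⪰ 0`, so `det W′ = det M · det W ≥ det W`. Horn–Johnson Cor. 7.7.4 (e): «If A ⪰ B ⪰ 0, then
det A ≥ det B ≥ 0» (here with `B ≻ 0`; Mathlib has `PosSemidef.det_nonneg`, `PosDef.det_pos`, not this monotonicity; the tree's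
`MinkowskiDet.det_le_det_add_of_posSemidef` is the real-symmetric case). [cite: HornJohnson2013, Cor. 7.7.4 (e) (p0606)] -/
theorem det_le_det_of_posDef_of_sub_posSemidef {W W' : Matrix ι ι ℂ} (hW : W.PosDef)
    (h : (W' - W).PosSemidef) : W.det ≤ W'.det := by
  obtain ⟨A, hA⟩ := CStarAlgebra.nonneg_iff_eq_star_mul_self.mp hW.posSemidef.nonneg
  have hWA : W = Aᴴ * A := by rw [hA, star_eq_conjTranspose]
  have hdetW : W.det = star A.det * A.det := by rw [hWA, det_mul, det_conjTranspose]
  have hdetA : IsUnit A.det := by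
    rw [isUnit_iff_ne_zero]
    intro h0
    have h1 := hW.det_pos
    rw [hdetW, h0, mul_zero] at h1
    exact lt_irrefl _ h1
  set B : Matrix ι ι ℂ := A⁻¹ with hB
  have hAB : A * B = 1 := mul_nonsing_inv A hdetA
  have hBA : B * A = 1 := nonsing_inv_mul A hdetA
  set M : Matrix ι ι ℂ := Bᴴ * W' * B with hM
  have hW'M : W' = Aᴴ * M * A := by
    calc W' = (B * A)ᴴ * W' * (B * A) := by rw [hBA, conjTranspose_one, Matrix.one_mul, Matrix.mul_one]
      _ = Aᴴ * (Bᴴ * W' * B) * A := by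
        rw [conjTranspose_mul]
        simp only [Matrix.mul_assoc]
  have hBWB : Bᴴ * W * B = 1 := by
    calc Bᴴ * W * B = (A * B)ᴴ * (A * B) := by
          rw [hWA, conjTranspose_mul]
          simp only [Matrix.mul_assoc]
      _ = 1 := by rw [hAB, conjTranspose_one, Matrix.mul_one]
  have hM1 : (M - 1).PosSemidef := by
    have : M - 1 = Bᴴ * (W' - W) * B := by rw [Matrix.mul_sub, Matrix.sub_mul, hBWB]
    rw [this]
    exact h.conjTranspose_mul_mul_same B
  have hdetM : (1 : ℂ) ≤ M.det := one_le_det_of_sub_one_posSemidef hM1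
  have hdet : W'.det = M.det * W.det := by
    rw [hW'M, det_mul, det_mul, det_conjTranspose, hdetW]
    ring
  rw [hdet]
  calc W.det = 1 * W.det := (one_mul _).symm
    _ ≤ M.det * W.det := mul_le_mul_of_nonneg_right hdetM hW.posSemidef.det_nonneg

end Folklore

/-! ## §1 The objects: (VI.6) on the unit sphere, the cross-ordered `BF` as a 4 × 4 matrix of 3 × 3 blocks -/

section Objects

variable (ζ w ψ x y n₀ n₁ n₂ n₃ : ℝ)

/-- The ring of 4 × 4 block matrices with 3 × 3 complex blocks (space-time index `μ` outside, su(2) colour index inside), the shape of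
«the twelve by twelve matrix (VI.9)» (p.373 tl.17). [cite: MagnenRivasseauSeneor1993, §VI (VI.9) p.370] -/
abbrev Blk := Matrix (Fin 4) (Fin 4) (Matrix (Fin 3) (Fin 3) ℂ)

/-- `Σ_σ P_σP_σ` for the matrices (VI.6) at momentum `n` and background `(x, y)` — «−D² = P²» (VI.8) before the sphere normalisation
(`sum_Pmat_sq`: `= PsqUnit` on `Σn_σ² = 1`). [cite: MagnenRivasseauSeneor1993, §VI (VI.6), (VI.8) pp.369–370] -/
def Psum2 : Matrix (Fin 3) (Fin 3) ℂ := ∑ σ, Pmat n₀ n₁ n₂ n₃ x y σ * Pmat n₀ n₁ n₂ n₃ x y σ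

/-- The scalar 4 × 4 factor `g_{σν} = δ_{σν} + (w − 1)n_σn_ν` of (VI.9) — «(δ_σν + (ζ⁻¹ − 1)p_σp_ν/p²)» on `|p| = 1`, `w` for `ζ⁻¹`
(`= p²(−Δ^{homothetic})⁻¹`, the inverse of the flat homothetic operator «δ_μν p² − 10/13 p_μp_ν» of (A.27)). [cite: MagnenRivasseauSeneor1993, §VI (VI.9) p.370; App. 1 (A.27) p.382] -/
def Gs : Matrix (Fin 4) (Fin 4) ℂ :=
  Matrix.of fun μ ν => ((((if μ = ν then (1 : ℝ) else 0) + (w - 1) * nvec n₀ n₁ n₂ n₃ μ * nvec n₀ n₁ n₂ n₃ ν : ℝ)) : ℂ)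

/-- Its inverse on the unit sphere when `ζw = 1` (`Gsinv_mul_Gs`): `δ_{σν} − (1 − ζ)n_σn_ν` — the flat homothetic operator «δ_μν p² − 10/13 p_μp_ν»
of (A.27) on `|p| = 1` (`1 − ζ = 10/13` at `ζ = 3/13`). [cite: MagnenRivasseauSeneor1993, App. 1 (A.27) p.382] -/
def Gsinv : Matrix (Fin 4) (Fin 4) ℂ :=
  Matrix.of fun μ ν => ((((if μ = ν then (1 : ℝ) else 0) - (1 - ζ) * nvec n₀ n₁ n₂ n₃ μ * nvec n₀ n₁ n₂ n₃ ν : ℝ)) : ℂ)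

/-- The block form of `g`: block `(σ, ν)` is `g_{σν}·1₃` (a ring homomorphism of `Gs`, so that `g⁻¹g = 1` lifts: `blkGinv_mul_blkG`).
[cite: MagnenRivasseauSeneor1993, §VI (VI.9) p.370] -/
def blkG : Blk := (algebraMap ℂ (Matrix (Fin 3) (Fin 3) ℂ)).mapMatrix (Gs w n₀ n₁ n₂ n₃)

/-- The block form of `g⁻¹`: block `(σ, ν)` is `(δ_{σν} − (1 − ζ)n_σn_ν)·1₃`. [cite: MagnenRivasseauSeneor1993, §VI (VI.9) p.370; App. 1 (A.27) p.382] -/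
def blkGinv : Blk := (algebraMap ℂ (Matrix (Fin 3) (Fin 3) ℂ)).mapMatrix (Gsinv ζ n₀ n₁ n₂ n₃)

/-- The CROSS-ordered covariant homothetic operator `A_{μν} = P²δ_{μν} − (1 − ζ)P_νP_μ` as a block matrix — «δ_μν D² − 10/13 ∇_μ∇_ν» of
(A.27) in the index order of p.357 tl.10 («Σ_μΣ_ν(∂_μA_ν)² + (ζ − 1)Σ_μΣ_ν(∂_μA_ν)(∂_νA_μ)», `∂ → D`), whose quadratic form is file 15's
`formCross` (`qf_blkA`); the literal display order of (VI.9) would be `P_μP_ν` (DIV form). [cite: MagnenRivasseauSeneor1993, App. 1 (A.27) p.382; §IV p.357; §VI (VI.9) p.370] -/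
def blkA : Blk := Matrix.of fun μ ν =>
  ((if μ = ν then (1 : ℝ) else 0 : ℝ) : ℂ) • Psum2 x y n₀ n₁ n₂ n₃
    - ((1 - ζ : ℝ) : ℂ) • (Pmat n₀ n₁ n₂ n₃ x y ν * Pmat n₀ n₁ n₂ n₃ x y μ)

/-- The cross-ordered `BF` of (VI.9) as a block matrix: `δ_{μν}·1 + BFm1Cross_{μν}` — EXACTLY file 15's blocks `HomotheticA27.BFm1Cross`
((VI.9) first line with the `(1 − ζ)`-blocks transposed, on the unit sphere). [cite: MagnenRivasseauSeneor1993, §VI (VI.9) p.370; §IV p.357] -/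
def blkBF : Blk := Matrix.of fun μ ν => (if μ = ν then (1 : Matrix (Fin 3) (Fin 3) ℂ) else 0) + BFm1Cross ζ w ψ x y n₀ n₁ n₂ n₃ μ ν

/-- The Hermitian factor `H = (1 − ψ)g⁻¹ + ψA`, so that `BF_cross = 1 + ψ[Ag − 1] = H·g` (`blkBF_eq_mul`). [cite: MagnenRivasseauSeneor1993, §VI (VI.9) p.370] -/
def blkH : Blk := ((1 - ψ : ℝ) : ℂ) • blkGinv ζ n₀ n₁ n₂ n₃ + (ψ : ℂ) • blkA ζ x y n₀ n₁ n₂ n₃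

/-- The Feynman-gauge (`ζ = 1`) block `(1 − ψ)·1 + ψΣP_σ² = 1 + ψ(P² − p²) = 1 + ψU` of (VI.10) on `|p| = 1` («In the case of the Feynman
gauge ζ = 1, this determinant simplifies into a three by three determinant to the fourth power», p.372 tl.34–36); `= FeynmanGauge.onePlusPsiU`
of file 9 (`M3_eq_onePlusPsiU`), whose determinant is the (VI.15)/(A.6) cubic (`FeynmanGauge.det_onePlusPsiU`). [cite: MagnenRivasseauSeneor1993, §VI (VI.10) p.370, (VI.15) p.372; App. 1 (A.6) p.379] -/
def M3 : Matrix (Fin 3) (Fin 3) ℂ := ((1 - ψ : ℝ) : ℂ) • (1 : Matrix (Fin 3) (Fin 3) ℂ) + (ψ : ℂ) • Psum2 x y n₀ n₁ n₂ n₃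

/-- The Feynman-gauge `BF|_{ζ=1} = δ_{μν}(1 + ψU)` as a block matrix («(−Δ_B)… in the Feynman case of ordinary Laplacians», p.383 tl.2–3).
[cite: MagnenRivasseauSeneor1993, §VI (VI.9)–(VI.10) p.370; App. 1 p.383] -/
def blkHF : Blk := Matrix.of fun μ ν => ((if μ = ν then (1 : ℝ) else 0 : ℝ) : ℂ) • M3 ψ x y n₀ n₁ n₂ n₃

/-- **The 12 × 12 cross-ordered `BF`** (index `(μ, a)`, `μ ∈ Fin 4`, `a ∈ Fin 3`), `BF12Cross (μ,a) (ν,b) = δ + BFm1Cross μ ν a b`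
(`BF12Cross_apply`; same indexing as file 17's `DetSign.BF12` for the literal ordering). «1 + βP» of (VI.14)/Lemma VI.2 `= det BF`.
[cite: MagnenRivasseauSeneor1993, §VI (VI.9) p.370, (VI.14) p.372] -/
def BF12Cross : Matrix (Fin 4 × Fin 3) (Fin 4 × Fin 3) ℂ := Matrix.comp _ _ _ _ _ (blkBF ζ w ψ x y n₀ n₁ n₂ n₃)

end Objects

/-! ## §2 Three-by-three identities on the unit sphere -/

section Sphere

variable {n₀ n₁ n₂ n₃ : ℝ} (x y : ℝ)

/-- `Σ_σ n_σ² = n₀² + n₁² + n₂² + n₃²` (plumbing). [folklore] -/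
private theorem sum_nvec_sq (n₀ n₁ n₂ n₃ : ℝ) : ∑ σ, nvec n₀ n₁ n₂ n₃ σ ^ 2 = n₀ ^ 2 + n₁ ^ 2 + n₂ ^ 2 + n₃ ^ 2 := by
  simp [nvec, Fin.sum_univ_four]

/-- `Σ_σ P_σ² = P²|_{p²=1}` (file 10's `BosonTrace.PsqUnit`, (VI.8) with `p² = 1`) on the unit sphere. [cite: MagnenRivasseauSeneor1993, §VI (VI.8) p.370] -/
theorem sum_Pmat_sq (h : n₀ ^ 2 + n₁ ^ 2 + n₂ ^ 2 + n₃ ^ 2 = 1) :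
    Psum2 x y n₀ n₁ n₂ n₃ = PsqUnit n₁ n₂ x y := by
  have hc : (n₀ : ℂ) ^ 2 + n₁ ^ 2 + n₂ ^ 2 + n₃ ^ 2 = 1 := by exact_mod_cast h
  ext a b
  fin_cases a <;> fin_cases b <;> simp [Psum2, PsqUnit, Pmat, Fin.sum_univ_four] <;> ring_nf <;>
    first | rfl | linear_combination hc | (simp only [Complex.I_sq]; linear_combination hc)

/-- `Σ_σ n_σ P_σ = K_FP|_{p²=1}` (file 10's `BosonTrace.KFPUnit`, (VI.7) «K_FP = −∂·D = Σ_μ p_μP_μ» with `p² = 1`) on the unit sphere.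
[cite: MagnenRivasseauSeneor1993, §VI (VI.7) p.369] -/
theorem sum_nvec_Pmat (h : n₀ ^ 2 + n₁ ^ 2 + n₂ ^ 2 + n₃ ^ 2 = 1) :
    ∑ σ, ((nvec n₀ n₁ n₂ n₃ σ : ℝ) : ℂ) • Pmat n₀ n₁ n₂ n₃ x y σ = KFPUnit n₁ n₂ x y := by
  have hc : (n₀ : ℂ) ^ 2 + n₁ ^ 2 + n₂ ^ 2 + n₃ ^ 2 = 1 := by exact_mod_cast h
  ext a b
  fin_cases a <;> fin_cases b <;> simp [KFPUnit, Pmat, nvec, Fin.sum_univ_four] <;> ring_nf <;>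
    first | rfl | linear_combination hc

/-- **`(1 − ψ) + ψΣP_σ² = 1 + ψU` is file 9's `FeynmanGauge.onePlusPsiU`** (entries `X = ψx²`, `Y = ψy²`, `m₁ = ψn₁x`, `m₂ = ψn₂y`) on
the unit sphere — so `det BF|_{ζ=1} = (det(1 + ψU))⁴` is the (VI.15)/(A.6) quantity whose Lemma VI.2 is PROVED in file 9
(`FeynmanGauge.det_onePlusPsiU`, `lemmaVI2_feynmanGauge`). [cite: MagnenRivasseauSeneor1993, §VI (VI.10) p.370, (VI.15) p.372; App. 1 (A.6) p.379] -/
theorem M3_eq_onePlusPsiU (ψ : ℝ) (h : n₀ ^ 2 + n₁ ^ 2 + n₂ ^ 2 + n₃ ^ 2 = 1) :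
    M3 ψ x y n₀ n₁ n₂ n₃ = onePlusPsiU (ψ * x ^ 2) (ψ * y ^ 2) (ψ * n₁ * x) (ψ * n₂ * y) := by
  rw [M3, sum_Pmat_sq x y h]
  ext a b
  fin_cases a <;> fin_cases b <;> simp [PsqUnit, onePlusPsiU, Matrix.smul_apply] <;> ring

/-- The outer product `N_{μν} = n_μn_ν` («p_σp_ν/p²» on `|p| = 1`). [cite: MagnenRivasseauSeneor1993, §VI (VI.9) p.370] -/
def Nout (n₀ n₁ n₂ n₃ : ℝ) : Matrix (Fin 4) (Fin 4) ℂ :=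
  Matrix.of fun μ ν => ((nvec n₀ n₁ n₂ n₃ μ * nvec n₀ n₁ n₂ n₃ ν : ℝ) : ℂ)

/-- `N² = |n|²·N` (plumbing for `g⁻¹g = 1`). [folklore] -/
private theorem Nout_mul_Nout (n₀ n₁ n₂ n₃ : ℝ) :
    Nout n₀ n₁ n₂ n₃ * Nout n₀ n₁ n₂ n₃ = ((n₀ ^ 2 + n₁ ^ 2 + n₂ ^ 2 + n₃ ^ 2 : ℝ) : ℂ) • Nout n₀ n₁ n₂ n₃ := by
  ext μ ν
  simp [Nout, Matrix.mul_apply, Fin.sum_univ_four, nvec]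
  ring

/-- `g = 1 + (w − 1)N`. [cite: MagnenRivasseauSeneor1993, §VI (VI.9) p.370] -/
theorem Gs_eq (w n₀ n₁ n₂ n₃ : ℝ) : Gs w n₀ n₁ n₂ n₃ = 1 + ((w - 1 : ℝ) : ℂ) • Nout n₀ n₁ n₂ n₃ := by
  ext μ ν
  simp [Gs, Nout, Matrix.one_apply]
  split_ifs <;> push_cast <;> ring

/-- `g⁻¹ = 1 − (1 − ζ)N`. [cite: MagnenRivasseauSeneor1993, App. 1 (A.27) p.382] -/
theorem Gsinv_eq (ζ n₀ n₁ n₂ n₃ : ℝ) : Gsinv ζ n₀ n₁ n₂ n₃ = 1 - ((1 - ζ : ℝ) : ℂ) • Nout n₀ n₁ n₂ n₃ := by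
  ext μ ν
  simp [Gsinv, Nout, Matrix.one_apply]
  split_ifs <;> push_cast <;> ring

/-- `g⁻¹ g = 1` on the unit sphere for `ζw = 1`: `(δ − (1 − ζ)N)(δ + (ζ⁻¹ − 1)N) = δ` since `N² = N` — the flat homothetic propagator
«δ_ab(δ_μν − (1 − ζ⁻¹)p_μp_ν/p²)/p²» (III.3) inverts «δ_μν p² − (1 − ζ)p_μp_ν». [cite: MagnenRivasseauSeneor1993, §III (III.3) p.348; §VI (VI.9) p.370] -/
theorem Gsinv_mul_Gs {ζ w : ℝ} (hw : ζ * w = 1) (h : n₀ ^ 2 + n₁ ^ 2 + n₂ ^ 2 + n₃ ^ 2 = 1) :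
    Gsinv ζ n₀ n₁ n₂ n₃ * Gs w n₀ n₁ n₂ n₃ = 1 := by
  rw [Gs_eq, Gsinv_eq, Matrix.sub_mul, Matrix.mul_add, Matrix.mul_add, Matrix.one_mul, Matrix.mul_one, Matrix.one_mul,
    Matrix.smul_mul, Matrix.mul_smul, Nout_mul_Nout, h]
  have hwc : (w : ℂ) - 1 - (1 - ζ) - (1 - ζ) * (w - 1) = 0 := by
    have : (ζ : ℂ) * w = 1 := by exact_mod_cast hw
    linear_combination this
  have : ((w - 1 : ℝ) : ℂ) • Nout n₀ n₁ n₂ n₃ - (((1 - ζ : ℝ) : ℂ) • Nout n₀ n₁ n₂ n₃ +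
      ((1 - ζ : ℝ) : ℂ) • (((w - 1 : ℝ) : ℂ) • ((1 : ℝ) : ℂ) • Nout n₀ n₁ n₂ n₃)) = 0 := by
    rw [← sub_sub, smul_smul, smul_smul, ← sub_smul, ← sub_smul]
    push_cast
    rw [mul_one, hwc, zero_smul]
  rw [add_sub_assoc, this, add_zero]

/-- `det g = 1 + (w − 1)|n|²` (rank-one update), `= w = ζ⁻¹` on the unit sphere. [cite: MagnenRivasseauSeneor1993, §VI (VI.9) p.370] -/
theorem det_Gs (w : ℝ) (h : n₀ ^ 2 + n₁ ^ 2 + n₂ ^ 2 + n₃ ^ 2 = 1) : (Gs w n₀ n₁ n₂ n₃).det = (w : ℂ) := by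
  have hc : (n₀ : ℂ) ^ 2 + n₁ ^ 2 + n₂ ^ 2 + n₃ ^ 2 = 1 := by exact_mod_cast h
  have hG : Gs w n₀ n₁ n₂ n₃ = 1 + replicateCol (Fin 1) (fun μ => (((w - 1) * nvec n₀ n₁ n₂ n₃ μ : ℝ) : ℂ)) *
      replicateRow (Fin 1) (fun μ => ((nvec n₀ n₁ n₂ n₃ μ : ℝ) : ℂ)) := by
    ext μ ν
    simp [Gs, Matrix.mul_apply, Matrix.one_apply]
    split_ifs <;> push_cast <;> ring
  rw [hG]
  refine (det_one_add_replicateCol_mul_replicateRow (ι := Fin 1) _ _).trans ?_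
  simp [dotProduct, Fin.sum_univ_four, nvec]
  linear_combination (↑w - 1 : ℂ) * hc

end Sphere

/-! ## §3 Block identities: `BF_cross = H · g`, `det g = w³` -/

section Blocks

variable (ζ w ψ x y n₀ n₁ n₂ n₃ : ℝ)

/-- Blocks of `g`: `g_{μν}·1₃`. [cite: MagnenRivasseauSeneor1993, §VI (VI.9) p.370] -/
theorem blkG_apply (μ ν : Fin 4) :
    blkG w n₀ n₁ n₂ n₃ μ ν = Gs w n₀ n₁ n₂ n₃ μ ν • (1 : Matrix (Fin 3) (Fin 3) ℂ) := by
  simp [blkG, Algebra.algebraMap_eq_smul_one]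

/-- Blocks of `g⁻¹`: `(δ_{μν} − (1 − ζ)n_μn_ν)·1₃`. [cite: MagnenRivasseauSeneor1993, App. 1 (A.27) p.382] -/
theorem blkGinv_apply (μ ν : Fin 4) :
    blkGinv ζ n₀ n₁ n₂ n₃ μ ν = Gsinv ζ n₀ n₁ n₂ n₃ μ ν • (1 : Matrix (Fin 3) (Fin 3) ℂ) := by
  simp [blkGinv, Algebra.algebraMap_eq_smul_one]

variable {ζ w ψ x y n₀ n₁ n₂ n₃}

/-- `g⁻¹g = 1` at the block level. [cite: MagnenRivasseauSeneor1993, §VI (VI.9) p.370] -/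
theorem blkGinv_mul_blkG (hw : ζ * w = 1) (h : n₀ ^ 2 + n₁ ^ 2 + n₂ ^ 2 + n₃ ^ 2 = 1) :
    blkGinv ζ n₀ n₁ n₂ n₃ * blkG w n₀ n₁ n₂ n₃ = 1 := by
  unfold blkGinv blkG
  rw [← map_mul, Gsinv_mul_Gs hw h, map_one]

/-- **The link to file 15's blocks** (the object identity of record): on the unit sphere, `δ_{μν} + BFm1Cross_{μν} = [(1 − ψ)·1 + ψ·(A·g)]_{μν}`
for all sixteen blocks — i.e. `BF = δ_μν + ψ[Σ_σ(P²δ_μσ − (1 − ζ)P_σP_μ)(δ_σν + (ζ⁻¹ − 1)n_σn_ν) − δ_μν]` ((VI.9) first line, cross order)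
IS `1 + ψ(Ag − 1)`. [cite: MagnenRivasseauSeneor1993, §VI (VI.9) p.370] -/
theorem blkBF_eq (h : n₀ ^ 2 + n₁ ^ 2 + n₂ ^ 2 + n₃ ^ 2 = 1) :
    blkBF ζ w ψ x y n₀ n₁ n₂ n₃ =
      ((1 - ψ : ℝ) : ℂ) • (1 : Blk) + (ψ : ℂ) • (blkA ζ x y n₀ n₁ n₂ n₃ * blkG w n₀ n₁ n₂ n₃) := by
  apply Matrix.ext
  intro μ ν
  simp only [blkBF, BFm1Cross, Matrix.of_apply]
  rw [← sum_Pmat_sq x y h, ← sum_nvec_Pmat x y h]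
  simp only [Matrix.add_apply, Matrix.smul_apply, Matrix.mul_apply, blkG_apply, blkA, Matrix.of_apply, Matrix.one_apply,
    Matrix.mul_smul, Matrix.mul_one, Fin.sum_univ_four, Gs]
  fin_cases μ <;> fin_cases ν <;> simp [nvec, add_mul, -Complex.coe_smul] <;> module

/-- `BF_cross = H·g` (block level; uses `g⁻¹g = 1`). [cite: MagnenRivasseauSeneor1993, §VI (VI.9) p.370] -/
theorem blkBF_eq_mul (hw : ζ * w = 1) (h : n₀ ^ 2 + n₁ ^ 2 + n₂ ^ 2 + n₃ ^ 2 = 1) :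
    blkBF ζ w ψ x y n₀ n₁ n₂ n₃ = blkH ζ ψ x y n₀ n₁ n₂ n₃ * blkG w n₀ n₁ n₂ n₃ := by
  rw [blkBF_eq h, blkH, Matrix.add_mul, Matrix.smul_mul, Matrix.smul_mul, blkGinv_mul_blkG hw h]

/-- `BF_cross = H·g` (12 × 12; `Matrix.comp` is a ring isomorphism). [cite: MagnenRivasseauSeneor1993, §VI (VI.9) p.370] -/
theorem BF12Cross_eq_mul (hw : ζ * w = 1) (h : n₀ ^ 2 + n₁ ^ 2 + n₂ ^ 2 + n₃ ^ 2 = 1) :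
    BF12Cross ζ w ψ x y n₀ n₁ n₂ n₃ =
      Matrix.comp _ _ _ _ _ (blkH ζ ψ x y n₀ n₁ n₂ n₃) * Matrix.comp _ _ _ _ _ (blkG w n₀ n₁ n₂ n₃) := by
  unfold BF12Cross
  rw [blkBF_eq_mul hw h]
  exact (compRingEquiv (Fin 4) (Fin 3) ℂ).map_mul _ _

/-- `g` as a 12 × 12 matrix is the Kronecker product `Gs ⊗ 1₃`. [cite: MagnenRivasseauSeneor1993, §VI (VI.9) p.370] -/
theorem comp_blkG (w n₀ n₁ n₂ n₃ : ℝ) :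
    Matrix.comp _ _ _ _ _ (blkG w n₀ n₁ n₂ n₃) = Gs w n₀ n₁ n₂ n₃ ⊗ₖ (1 : Matrix (Fin 3) (Fin 3) ℂ) := by
  ext ⟨μ, a⟩ ⟨ν, b⟩
  simp [blkG_apply, Matrix.kroneckerMap_apply, Matrix.one_apply]

/-- `BF|_{ζ=1}` as a 12 × 12 matrix is `1₄ ⊗ (1 + ψU)` («a three by three determinant to the fourth power», p.372 tl.35). [cite: MagnenRivasseauSeneor1993, §VI (VI.15) p.372] -/
theorem comp_blkHF (ψ x y n₀ n₁ n₂ n₃ : ℝ) :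
    Matrix.comp _ _ _ _ _ (blkHF ψ x y n₀ n₁ n₂ n₃) = (1 : Matrix (Fin 4) (Fin 4) ℂ) ⊗ₖ M3 ψ x y n₀ n₁ n₂ n₃ := by
  ext ⟨μ, a⟩ ⟨ν, b⟩
  by_cases hμν : μ = ν <;> simp [blkHF, Matrix.kroneckerMap_apply, hμν]

/-- `det g = (det Gs)³ = w³ = ζ⁻³` (12 × 12, unit sphere; `g = Gs ⊗ 1₃`). [cite: MagnenRivasseauSeneor1993, §VI (VI.9) p.370] -/
theorem det_comp_blkG (w : ℝ) (h : n₀ ^ 2 + n₁ ^ 2 + n₂ ^ 2 + n₃ ^ 2 = 1) :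
    (Matrix.comp _ _ _ _ _ (blkG w n₀ n₁ n₂ n₃)).det = (w : ℂ) ^ 3 := by
  rw [comp_blkG, det_kronecker, det_Gs w h]
  simp

/-- `det BF|_{ζ=1} = det(1 + ψU)⁴`. [cite: MagnenRivasseauSeneor1993, §VI (VI.15) p.372] -/
theorem det_comp_blkHF (ψ x y n₀ n₁ n₂ n₃ : ℝ) :
    (Matrix.comp _ _ _ _ _ (blkHF ψ x y n₀ n₁ n₂ n₃)).det = (M3 ψ x y n₀ n₁ n₂ n₃).det ^ 4 := by
  rw [comp_blkHF, det_kronecker]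
  simp

/-- **`det BF_cross = det H · w³`** (`w = ζ⁻¹`): the determinant «1 + βP» of (VI.14) for the cross ordering, factorised through the
Hermitian `H = (1 − ψ)g⁻¹ + ψA`. [cite: MagnenRivasseauSeneor1993, §VI (VI.9) p.370, (VI.14) p.372] -/
theorem det_BF12Cross (hw : ζ * w = 1) (h : n₀ ^ 2 + n₁ ^ 2 + n₂ ^ 2 + n₃ ^ 2 = 1) :
    (BF12Cross ζ w ψ x y n₀ n₁ n₂ n₃).det = (Matrix.comp _ _ _ _ _ (blkH ζ ψ x y n₀ n₁ n₂ n₃)).det * (w : ℂ) ^ 3 := by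
  rw [BF12Cross_eq_mul hw h, det_mul, det_comp_blkG w h]

end Blocks

/-! ## §4 `H − ζ·BF|_{ζ=1} ⪰ 0`: the covariant (A.27) for the cross form, at the level of 12 × 12 Hermitian matrices -/

section Forms

variable (ζ w ψ x y n₀ n₁ n₂ n₃ : ℝ)

/-- The block quadratic form `Σ_{μν} ⟨a_μ, B_{μν} a_ν⟩` (`⟨u, v⟩ = star u ⬝ᵥ v` on `ℂ³`), the language of file 15 §2. [cite: MagnenRivasseauSeneor1993, App. 1 (A.27) p.382] -/
def qf (B : Blk) (a : Fin 4 → Fin 3 → ℂ) : ℂ := ∑ μ, ∑ ν, star (a μ) ⬝ᵥ (B μ ν *ᵥ a ν)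

/-- The quadratic form of a 12 × 12 block matrix is the block quadratic form `qf` (plumbing for the block-operator dictionary of (A.27)/(VI.9),
cf. file 15 `star_mulVec_dotProduct_mulVec`). [cite: MagnenRivasseauSeneor1993, §VI (VI.9) p.370; App. 1 (A.27) p.382] -/
theorem star_dotProduct_comp_mulVec (B : Blk) (v : Fin 4 × Fin 3 → ℂ) :
    star v ⬝ᵥ (Matrix.comp _ _ _ _ _ B *ᵥ v) = qf B (fun μ c => v (μ, c)) := by
  simp only [qf, dotProduct, Matrix.mulVec, Matrix.comp_apply, Fintype.sum_prod_type, Finset.mul_sum, Pi.star_apply]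
  refine Finset.sum_congr rfl fun μ _ => ?_
  rw [Finset.sum_comm]

/-- `qf` is additive in the block matrix. [folklore] -/
private theorem qf_add (B C : Blk) (a : Fin 4 → Fin 3 → ℂ) : qf (B + C) a = qf B a + qf C a := by
  simp [qf, Matrix.add_mulVec, dotProduct_add, Finset.sum_add_distrib]

/-- `qf` respects subtraction. [folklore] -/
private theorem qf_sub (B C : Blk) (a : Fin 4 → Fin 3 → ℂ) : qf (B - C) a = qf B a - qf C a := by
  simp [qf, Matrix.sub_mulVec, dotProduct_sub, Finset.sum_sub_distrib]

/-- `qf` is homogeneous in the block matrix. [folklore] -/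
private theorem qf_smul (c : ℂ) (B : Blk) (a : Fin 4 → Fin 3 → ℂ) : qf (c • B) a = c * qf B a := by
  simp [qf, Matrix.smul_mulVec, dotProduct_smul, Finset.mul_sum]

/-- A Kronecker delta in front of a block: `Σ_{μν} δ_{μν}⟨a_μ, M_{μν}a_ν⟩ = Σ_μ ⟨a_μ, M_{μμ}a_μ⟩`. [folklore] -/
private theorem qf_delta_smul (M : Fin 4 → Fin 4 → Matrix (Fin 3) (Fin 3) ℂ) (a : Fin 4 → Fin 3 → ℂ) :
    qf (Matrix.of fun μ ν => ((if μ = ν then (1 : ℝ) else 0 : ℝ) : ℂ) • M μ ν) a = ∑ μ, star (a μ) ⬝ᵥ (M μ μ *ᵥ a μ) := by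
  unfold qf
  refine Finset.sum_congr rfl fun μ _ => ?_
  rw [Finset.sum_eq_single μ]
  · simp
  · intro ν _ hνμ
    simp [Ne.symm hνμ]
  · simp

/-- A scalar block `c_{μν}·1₃`: `Σ_{μν}⟨a_μ, c_{μν}a_ν⟩ = Σ_{μν} c_{μν}⟨a_μ, a_ν⟩`. [folklore] -/
private theorem qf_scalar (c : Fin 4 → Fin 4 → ℂ) (a : Fin 4 → Fin 3 → ℂ) :
    qf (Matrix.of fun μ ν => c μ ν • (1 : Matrix (Fin 3) (Fin 3) ℂ)) a = ∑ μ, ∑ ν, c μ ν * (star (a μ) ⬝ᵥ a ν) := by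
  simp [qf, Matrix.smul_mulVec, dotProduct_smul]

variable {ζ w ψ x y n₀ n₁ n₂ n₃}

/-- The (VI.6) matrices are Hermitian (file 15 `Pmat_conjTranspose`; «The hermitian matrix −D² = P²», p.370). [cite: MagnenRivasseauSeneor1993, §VI (VI.6), (VI.8) pp.369–370] -/
theorem hP (μ : Fin 4) : (Pmat n₀ n₁ n₂ n₃ x y μ)ᴴ = Pmat n₀ n₁ n₂ n₃ x y μ := Pmat_conjTranspose _ _ _ _ _ _ μ

/-- `(Σ_σP_σ²)ᴴ = Σ_σP_σ²` («The hermitian matrix −D² = P²», p.370). [cite: MagnenRivasseauSeneor1993, §VI (VI.8) p.370] -/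
theorem Psum2_conjTranspose : (Psum2 x y n₀ n₁ n₂ n₃)ᴴ = Psum2 x y n₀ n₁ n₂ n₃ := by
  simp [Psum2, Matrix.conjTranspose_sum, Matrix.conjTranspose_mul, hP]

/-- `Σ_{μσ}‖P_σa_μ‖² = Σ_μ ⟨a_μ, (Σ_σP_σ²) a_μ⟩`: file 15's `formLap` («D²δ_μν») is the quadratic form of the block `δ_{μν}ΣP_σ²`.
[cite: MagnenRivasseauSeneor1993, App. 1 (A.27) p.382; §VI (VI.8) p.370] -/
theorem formLap_eq_qf (a : Fin 4 → Fin 3 → ℂ) :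
    formLap (Pmat n₀ n₁ n₂ n₃ x y) a = ∑ μ, star (a μ) ⬝ᵥ (Psum2 x y n₀ n₁ n₂ n₃ *ᵥ a μ) := by
  unfold formLap Psum2
  refine Finset.sum_congr rfl fun μ _ => ?_
  rw [Matrix.sum_mulVec, dotProduct_sum]
  refine Finset.sum_congr rfl fun σ _ => ?_
  rw [star_mulVec_dotProduct_mulVec, hP]

/-- **The quadratic form of `A` is file 15's CROSS form** `formCross P a ζ = Σ‖P_σa_μ‖² − (1 − ζ)Σ⟨P_νa_μ, P_μa_ν⟩` — the form for which
(A.27) holds with both printed constants (`A27_crossForm_matrix`). [cite: MagnenRivasseauSeneor1993, App. 1 (A.27) p.382; §IV p.357] -/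
theorem qf_blkA (a : Fin 4 → Fin 3 → ℂ) :
    qf (blkA ζ x y n₀ n₁ n₂ n₃) a = formCross (Pmat n₀ n₁ n₂ n₃ x y) a ζ := by
  have hsplit : blkA ζ x y n₀ n₁ n₂ n₃ =
      (Matrix.of fun μ ν => ((if μ = ν then (1 : ℝ) else 0 : ℝ) : ℂ) • (fun _ _ => Psum2 x y n₀ n₁ n₂ n₃) μ ν) -
        ((1 - ζ : ℝ) : ℂ) • (Matrix.of fun μ ν => Pmat n₀ n₁ n₂ n₃ x y ν * Pmat n₀ n₁ n₂ n₃ x y μ) := by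
    ext μ ν a b
    simp [blkA]
  rw [hsplit, qf_sub, qf_smul, qf_delta_smul, formCross, formLap_eq_qf, crossM_eq_sum hP]
  simp [qf]

/-- `Σ_μ ⟨a_μ, a_μ⟩ = ‖a‖²` (the form of «δ_μν p²» on `|p| = 1`). [cite: MagnenRivasseauSeneor1993, App. 1 (A.27) p.382] -/
def Nrm (a : Fin 4 → Fin 3 → ℂ) : ℂ := ∑ μ, star (a μ) ⬝ᵥ a μ

/-- `Σ_{μν} n_μn_ν⟨a_μ, a_ν⟩ = ‖Σ_μ n_μa_μ‖²` (the form of «p_μp_ν» on `|p| = 1`). [cite: MagnenRivasseauSeneor1993, App. 1 (A.27) p.382] -/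
def Xout (n₀ n₁ n₂ n₃ : ℝ) (a : Fin 4 → Fin 3 → ℂ) : ℂ :=
  ∑ μ, ((nvec n₀ n₁ n₂ n₃ μ : ℝ) : ℂ) * ∑ ν, ((nvec n₀ n₁ n₂ n₃ ν : ℝ) : ℂ) * (star (a μ) ⬝ᵥ a ν)

/-- The quadratic form of `BF|_{ζ=1}`: `(1 − ψ)‖a‖² + ψ·Σ‖P_σa_μ‖²`. [cite: MagnenRivasseauSeneor1993, §VI (VI.10) p.370; App. 1 (A.27) p.382] -/
theorem qf_blkHF (a : Fin 4 → Fin 3 → ℂ) :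
    qf (blkHF ψ x y n₀ n₁ n₂ n₃) a =
      ((1 - ψ : ℝ) : ℂ) * Nrm a + (ψ : ℂ) * formLap (Pmat n₀ n₁ n₂ n₃ x y) a := by
  have hsplit : blkHF ψ x y n₀ n₁ n₂ n₃ =
      Matrix.of fun μ ν => ((if μ = ν then (1 : ℝ) else 0 : ℝ) : ℂ) • (fun _ _ => M3 ψ x y n₀ n₁ n₂ n₃) μ ν := by
    ext μ ν a b
    simp [blkHF]
  rw [hsplit, qf_delta_smul, formLap_eq_qf, Nrm, Finset.mul_sum, Finset.mul_sum, ← Finset.sum_add_distrib]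
  refine Finset.sum_congr rfl fun μ _ => ?_
  simp [M3, Matrix.add_mulVec, Matrix.smul_mulVec, dotProduct_add, dotProduct_smul, Matrix.one_mulVec, -Complex.coe_smul]

/-- The quadratic form of `g⁻¹`: `‖a‖² − (1 − ζ)‖Σn_μa_μ‖²` (the flat half of (A.27), «δ_μν p² − 10/13 p_μp_ν», as a form). [cite: MagnenRivasseauSeneor1993, App. 1 (A.27) p.382] -/
theorem qf_blkGinv (a : Fin 4 → Fin 3 → ℂ) :
    qf (blkGinv ζ n₀ n₁ n₂ n₃) a = Nrm a - ((1 - ζ : ℝ) : ℂ) * Xout n₀ n₁ n₂ n₃ a := by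
  have hsplit : blkGinv ζ n₀ n₁ n₂ n₃ = Matrix.of fun μ ν => Gsinv ζ n₀ n₁ n₂ n₃ μ ν • (1 : Matrix (Fin 3) (Fin 3) ℂ) := by
    ext μ ν a b
    simp [blkGinv_apply]
  rw [hsplit, qf_scalar]
  have hterm : ∀ μ ν, Gsinv ζ n₀ n₁ n₂ n₃ μ ν * (star (a μ) ⬝ᵥ a ν) =
      (if μ = ν then star (a μ) ⬝ᵥ a ν else 0) -
        ((1 - ζ : ℝ) : ℂ) * (((nvec n₀ n₁ n₂ n₃ μ : ℝ) : ℂ) * (((nvec n₀ n₁ n₂ n₃ ν : ℝ) : ℂ) * (star (a μ) ⬝ᵥ a ν))) := by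
    intro μ ν
    by_cases hμν : μ = ν <;> simp [Gsinv, hμν] <;> ring
  simp_rw [hterm]
  simp only [Finset.sum_sub_distrib, Finset.sum_ite_eq, Finset.mem_univ, if_true, ← Finset.mul_sum]
  rfl

/-- Cauchy–Schwarz on the unit sphere: `‖Σ_μ n_μa_μ‖² ≤ Σ_μ ‖a_μ‖²` for `Σn_μ² = 1` — so the flat homothetic operator satisfies
`δ_μν p² − (1 − ζ)p_μp_ν ≥ ζ p²` (the lower companion of the printed «≤ 23/13 p²»). [cite: MagnenRivasseauSeneor1993, App. 1 (A.27) p.382] -/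
theorem Xout_re_le (h : n₀ ^ 2 + n₁ ^ 2 + n₂ ^ 2 + n₃ ^ 2 = 1) (a : Fin 4 → Fin 3 → ℂ) :
    (Xout n₀ n₁ n₂ n₃ a).re ≤ (Nrm a).re := by
  -- b_c = Σ_μ n_μ a_{μc}
  set b : Fin 3 → ℂ := fun c => ∑ μ, ((nvec n₀ n₁ n₂ n₃ μ : ℝ) : ℂ) * a μ c with hb
  have h1 : ∀ c, star (b c) * b c =
      ∑ μ, ∑ ν, ((nvec n₀ n₁ n₂ n₃ μ : ℝ) : ℂ) * (((nvec n₀ n₁ n₂ n₃ ν : ℝ) : ℂ) * (star (a μ c) * a ν c)) := by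
    intro c
    simp only [hb, star_sum, star_mul', Complex.star_def, Complex.conj_ofReal]
    rw [Finset.sum_mul_sum]
    refine Finset.sum_congr rfl fun μ _ => Finset.sum_congr rfl fun ν _ => ?_
    ring
  have hX : Xout n₀ n₁ n₂ n₃ a = ∑ c, star (b c) * b c := by
    calc Xout n₀ n₁ n₂ n₃ a
        = ∑ μ, ∑ ν, ∑ c, ((nvec n₀ n₁ n₂ n₃ μ : ℝ) : ℂ) * (((nvec n₀ n₁ n₂ n₃ ν : ℝ) : ℂ) * (star (a μ c) * a ν c)) := by
          simp only [Xout, dotProduct, Pi.star_apply, Finset.mul_sum]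
      _ = ∑ μ, ∑ c, ∑ ν, ((nvec n₀ n₁ n₂ n₃ μ : ℝ) : ℂ) * (((nvec n₀ n₁ n₂ n₃ ν : ℝ) : ℂ) * (star (a μ c) * a ν c)) :=
          Finset.sum_congr rfl fun μ _ => Finset.sum_comm
      _ = ∑ c, ∑ μ, ∑ ν, ((nvec n₀ n₁ n₂ n₃ μ : ℝ) : ℂ) * (((nvec n₀ n₁ n₂ n₃ ν : ℝ) : ℂ) * (star (a μ c) * a ν c)) :=
          Finset.sum_comm
      _ = ∑ c, star (b c) * b c := Finset.sum_congr rfl fun c _ => (h1 c).symm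
  have hN : (Nrm a).re = ∑ c, ∑ μ, ‖a μ c‖ ^ 2 := by
    calc (Nrm a).re = (∑ μ, ∑ c, star (a μ c) * a μ c).re := by simp only [Nrm, dotProduct, Pi.star_apply]
      _ = ∑ μ, ∑ c, ‖a μ c‖ ^ 2 := by
          rw [Complex.re_sum]
          refine Finset.sum_congr rfl fun μ _ => ?_
          rw [Complex.re_sum]
          refine Finset.sum_congr rfl fun c _ => ?_
          rw [Complex.star_def, Complex.conj_mul', ← Complex.ofReal_pow, Complex.ofReal_re]
      _ = ∑ c, ∑ μ, ‖a μ c‖ ^ 2 := Finset.sum_comm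
  rw [hX, hN, Complex.re_sum]
  refine Finset.sum_le_sum fun c _ => ?_
  rw [Complex.star_def, Complex.conj_mul', ← Complex.ofReal_pow, Complex.ofReal_re]
  have h1' : ‖b c‖ ≤ ∑ μ, |nvec n₀ n₁ n₂ n₃ μ| * ‖a μ c‖ := by
    refine (norm_sum_le _ _).trans (le_of_eq ?_)
    refine Finset.sum_congr rfl fun μ _ => ?_
    rw [norm_mul, Complex.norm_real, Real.norm_eq_abs]
  have h2 : (∑ μ, |nvec n₀ n₁ n₂ n₃ μ| * ‖a μ c‖) ^ 2 ≤ (∑ μ, |nvec n₀ n₁ n₂ n₃ μ| ^ 2) * ∑ μ, ‖a μ c‖ ^ 2 :=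
    Finset.sum_mul_sq_le_sq_mul_sq _ _ _
  have h3 : ∑ μ, |nvec n₀ n₁ n₂ n₃ μ| ^ 2 = 1 := by
    simp only [sq_abs, sum_nvec_sq, h]
  rw [h3, one_mul] at h2
  have h0 : 0 ≤ ∑ μ, |nvec n₀ n₁ n₂ n₃ μ| * ‖a μ c‖ := Finset.sum_nonneg fun μ _ => by positivity
  calc ‖b c‖ ^ 2 ≤ (∑ μ, |nvec n₀ n₁ n₂ n₃ μ| * ‖a μ c‖) ^ 2 := by gcongr
    _ ≤ ∑ μ, ‖a μ c‖ ^ 2 := h2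

/-- **`Re⟨v, (H − ζ·BF|_{ζ=1}) v⟩ ≥ 0`** for `ζ ≤ 1`, `0 ≤ ψ ≤ 1` on the unit sphere: it equals
`(1 − ψ)(1 − ζ)·[Σ‖a_μ‖² − ‖Σn_μa_μ‖²]` (Cauchy–Schwarz) `+ ψ·[Re formCross − ζ·Re formLap]` ((A.27) «δ_μν D² − 10/13 ∇_μ∇_ν ≥ 3/13 D²»,
cross form, file 15 `A27_crossForm_matrix`). [cite: MagnenRivasseauSeneor1993, App. 1 (A.27) p.382, p.383 tl.1–3] -/
theorem qf_re_nonneg (hζ1 : ζ ≤ 1) (hψ0 : 0 ≤ ψ) (hψ1 : ψ ≤ 1) (h : n₀ ^ 2 + n₁ ^ 2 + n₂ ^ 2 + n₃ ^ 2 = 1)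
    (a : Fin 4 → Fin 3 → ℂ) :
    0 ≤ (qf (blkH ζ ψ x y n₀ n₁ n₂ n₃ - (ζ : ℂ) • blkHF ψ x y n₀ n₁ n₂ n₃) a).re := by
  rw [qf_sub, qf_smul, blkH, qf_add, qf_smul, qf_smul, qf_blkGinv, qf_blkA, qf_blkHF]
  have hA := (A27_crossForm_matrix hζ1 (Pmat n₀ n₁ n₂ n₃ x y) a).1
  have hCS := Xout_re_le h a
  rw [formLap_re] at hA
  have hLre : (formLap (Pmat n₀ n₁ n₂ n₃ x y) a).re = gradSq (uOf (Pmat n₀ n₁ n₂ n₃ x y) a) := formLap_re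
  set N := Nrm a
  set X := Xout n₀ n₁ n₂ n₃ a
  set L := formLap (Pmat n₀ n₁ n₂ n₃ x y) a
  set C := formCross (Pmat n₀ n₁ n₂ n₃ x y) a ζ
  simp only [Complex.sub_re, Complex.add_re, Complex.mul_re, Complex.mul_im, Complex.sub_im,
    Complex.ofReal_re, Complex.ofReal_im, sub_zero, zero_mul, add_zero]
  rw [hLre]
  nlinarith [mul_nonneg (sub_nonneg.2 hψ1) (mul_nonneg (sub_nonneg.2 hζ1) (sub_nonneg.2 hCS)),
    mul_nonneg hψ0 (sub_nonneg.2 hA)]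

end Forms

/-! ## §5 The determinant transfer: `det BF_cross ≥ ζ⁹ · det BF|_{ζ=1}` -/

section Main

variable {ζ w ψ x y n₀ n₁ n₂ n₃ : ℝ}

/-- The 12 × 12 matrix of record, entrywise: `BF_cross (μ,a) (ν,b) = δ + BFm1Cross μ ν a b` (file 15's blocks; same shape as file 17's
`DetSign.BF12` for the literal ordering). [cite: MagnenRivasseauSeneor1993, §VI (VI.9) p.370] -/
theorem BF12Cross_apply (i j : Fin 4 × Fin 3) :
    BF12Cross ζ w ψ x y n₀ n₁ n₂ n₃ i j =
      (if i = j then (1 : ℂ) else 0) + BFm1Cross ζ w ψ x y n₀ n₁ n₂ n₃ i.1 j.1 i.2 j.2 := by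
  obtain ⟨μ, a⟩ := i
  obtain ⟨ν, b⟩ := j
  by_cases hμν : μ = ν
  · subst hμν
    by_cases hab : a = b <;> simp [BF12Cross, blkBF, hab]
  · simp [BF12Cross, blkBF, hμν]

/-- Hermitian-symmetric blocks (`(B_{νμ})ᴴ = B_{μν}`) give a Hermitian 12 × 12 matrix (plumbing for «The hermitian matrix −D² = P²» and the
Hermitian factor `H` of (VI.9)). [cite: MagnenRivasseauSeneor1993, §VI (VI.8)–(VI.9) p.370] -/
theorem isHermitian_comp {B : Blk} (hB : ∀ μ ν, (B ν μ)ᴴ = B μ ν) : (Matrix.comp _ _ _ _ _ B).IsHermitian := by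
  refine Matrix.IsHermitian.ext fun i j => ?_
  obtain ⟨μ, a⟩ := i
  obtain ⟨ν, b⟩ := j
  have := congrFun (congrFun (hB μ ν) a) b
  rwa [conjTranspose_apply] at this

/-- `(1 + ψU)ᴴ = 1 + ψU`. [cite: MagnenRivasseauSeneor1993, §VI (VI.10) p.370] -/
theorem M3_conjTranspose : (M3 ψ x y n₀ n₁ n₂ n₃)ᴴ = M3 ψ x y n₀ n₁ n₂ n₃ := by
  simp [M3, conjTranspose_add, conjTranspose_smul, Psum2_conjTranspose]

/-- The blocks of `H − ζ·BF|_{ζ=1}` are Hermitian-symmetric (`P_μ` Hermitian, real scalars; `(P_μP_ν)ᴴ = P_νP_μ`). [cite: MagnenRivasseauSeneor1993, §VI (VI.6), (VI.9) pp.369–370] -/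
theorem blkD_conjTranspose (μ ν : Fin 4) :
    ((blkH ζ ψ x y n₀ n₁ n₂ n₃ - (ζ : ℂ) • blkHF ψ x y n₀ n₁ n₂ n₃) ν μ)ᴴ =
      (blkH ζ ψ x y n₀ n₁ n₂ n₃ - (ζ : ℂ) • blkHF ψ x y n₀ n₁ n₂ n₃) μ ν := by
  by_cases hμν : μ = ν
  · subst hμν
    simp [blkH, blkHF, blkA, blkGinv_apply, Gsinv, conjTranspose_add, conjTranspose_sub, conjTranspose_smul,
      conjTranspose_mul, hP, Psum2_conjTranspose, M3_conjTranspose]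
  · simp [blkH, blkHF, blkA, blkGinv_apply, Gsinv, conjTranspose_add, conjTranspose_smul,
      conjTranspose_mul, hP, hμν, Ne.symm hμν]
    ring_nf

/-- `Σ_σP_σ² = Σ_σP_σᴴP_σ ⪰ 0` («The hermitian matrix −D² = P²», p.370). [cite: MagnenRivasseauSeneor1993, §VI (VI.8) p.370] -/
theorem Psum2_posSemidef : (Psum2 x y n₀ n₁ n₂ n₃).PosSemidef := by
  have hP2 : ∀ σ, (Pmat n₀ n₁ n₂ n₃ x y σ * Pmat n₀ n₁ n₂ n₃ x y σ).PosSemidef := fun σ => by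
    simpa [hP] using posSemidef_conjTranspose_mul_self (Pmat n₀ n₁ n₂ n₃ x y σ)
  unfold Psum2
  rw [Fin.sum_univ_four]
  exact (((hP2 0).add (hP2 1)).add (hP2 2)).add (hP2 3)

/-- `1 + ψU = (1 − ψ)·1 + ψΣP_σ² ⪰ 0` for `0 ≤ ψ ≤ 1`. [cite: MagnenRivasseauSeneor1993, §VI (VI.10) p.370] -/
theorem M3_posSemidef (hψ0 : 0 ≤ ψ) (hψ1 : ψ ≤ 1) : (M3 ψ x y n₀ n₁ n₂ n₃).PosSemidef := by
  unfold M3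
  refine (PosSemidef.one.smul ?_).add (Psum2_posSemidef.smul ?_)
  · exact Complex.zero_le_real.mpr (by exact_mod_cast sub_nonneg.mpr hψ1)
  · exact Complex.zero_le_real.mpr hψ0

/-- **`H − ζ·BF|_{ζ=1} ⪰ 0`** as 12 × 12 complex Hermitian matrices (`ζ ≤ 1`, `0 ≤ ψ ≤ 1`, unit sphere) — the operator inequality behind
«bounded up to a factor (3/23)¹² exactly by the same bound as in the Feynman case» (p.383 tl.2): `(1 − ψ)g⁻¹ + ψA ≥ ζ[(1 − ψ)·1 + ψP²δ_{μν}]`,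
from `g⁻¹ ≥ ζ·1` (Cauchy–Schwarz) and `A ≥ ζ·P²δ_{μν}` ((A.27), cross form). [cite: MagnenRivasseauSeneor1993, App. 1 (A.27) p.382, p.383 tl.1–7] -/
theorem posSemidef_sub (hζ1 : ζ ≤ 1) (hψ0 : 0 ≤ ψ) (hψ1 : ψ ≤ 1) (h : n₀ ^ 2 + n₁ ^ 2 + n₂ ^ 2 + n₃ ^ 2 = 1) :
    (Matrix.comp _ _ _ _ _ (blkH ζ ψ x y n₀ n₁ n₂ n₃) - (ζ : ℂ) • Matrix.comp _ _ _ _ _ (blkHF ψ x y n₀ n₁ n₂ n₃)).PosSemidef := by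
  have hcomp : Matrix.comp _ _ _ _ _ (blkH ζ ψ x y n₀ n₁ n₂ n₃) - (ζ : ℂ) • Matrix.comp _ _ _ _ _ (blkHF ψ x y n₀ n₁ n₂ n₃) =
      Matrix.comp _ _ _ _ _ (blkH ζ ψ x y n₀ n₁ n₂ n₃ - (ζ : ℂ) • blkHF ψ x y n₀ n₁ n₂ n₃) := by
    ext ⟨μ, a⟩ ⟨ν, b⟩
    simp
  rw [hcomp]
  have hH : (Matrix.comp _ _ _ _ _ (blkH ζ ψ x y n₀ n₁ n₂ n₃ - (ζ : ℂ) • blkHF ψ x y n₀ n₁ n₂ n₃)).IsHermitian :=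
    isHermitian_comp blkD_conjTranspose
  refine PosSemidef.of_dotProduct_mulVec_nonneg hH fun v => ?_
  have hre := qf_re_nonneg (x := x) (y := y) hζ1 hψ0 hψ1 h (fun μ c => v (μ, c))
  rw [← star_dotProduct_comp_mulVec] at hre
  have him := hH.im_star_dotProduct_mulVec_self v
  rw [RCLike.im_to_complex] at him
  exact Complex.nonneg_iff.mpr ⟨hre, him.symm⟩

/-- **THE DETERMINANT TRANSFER** — p.383 tl.5–7 «this proves that the determinant of (−Δ_B^{homothetic})(−Δ^{homothetic})⁻¹ is bounded
away from 0 up to a constant factor by the bound (A.6)», for the CROSS-ordered operator, with the constant made explicit: on the unit momentum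
sphere, for `0 < ζ ≤ 1`, `ζw = 1`, `0 ≤ ψ ≤ 1`, every background `(x, y)`:
`ζ⁹ · det((1 − ψ) + ψP²)⁴ = ζ⁹ · det BF|_{ζ=1} ≤ det BF_cross` (in the star order of `ℂ`; both sides are real). Proof: `det BF_cross = det H·w³`
(`det_BF12Cross`), `H ⪰ ζ·BF|_{ζ=1}` (`posSemidef_sub`), Loewner monotonicity of `det` (§0), `ζ¹²·w³ = ζ⁹`.
[cite: MagnenRivasseauSeneor1993, App. 1 p.383 tl.1–7; §VI (VI.9) p.370, (VI.14) p.372] -/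
theorem det_transfer (hζ0 : 0 < ζ) (hζ1 : ζ ≤ 1) (hw : ζ * w = 1) (hψ0 : 0 ≤ ψ) (hψ1 : ψ ≤ 1)
    (h : n₀ ^ 2 + n₁ ^ 2 + n₂ ^ 2 + n₃ ^ 2 = 1) :
    (ζ : ℂ) ^ 9 * (M3 ψ x y n₀ n₁ n₂ n₃).det ^ 4 ≤ (BF12Cross ζ w ψ x y n₀ n₁ n₂ n₃).det := by
  have hw0 : 0 < w := by
    by_contra hcon
    push Not at hcon
    nlinarith [mul_le_mul_of_nonneg_left hcon hζ0.le]
  set HC := Matrix.comp _ _ _ _ _ (blkH ζ ψ x y n₀ n₁ n₂ n₃) with hHC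
  set HF := Matrix.comp _ _ _ _ _ (blkHF ψ x y n₀ n₁ n₂ n₃) with hHFdef
  rw [det_BF12Cross hw h]
  have hHFpsd : HF.PosSemidef := by
    rw [hHFdef, comp_blkHF]
    exact PosSemidef.one.kronecker (M3_posSemidef hψ0 hψ1)
  have hHFdet : HF.det = (M3 ψ x y n₀ n₁ n₂ n₃).det ^ 4 := det_comp_blkHF ψ x y n₀ n₁ n₂ n₃
  have hD : (HC - (ζ : ℂ) • HF).PosSemidef := posSemidef_sub hζ1 hψ0 hψ1 h
  have hw3 : (0 : ℂ) ≤ (w : ℂ) ^ 3 := pow_nonneg (Complex.zero_le_real.mpr hw0.le) 3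
  have hζw : (ζ : ℂ) ^ 12 * (w : ℂ) ^ 3 = (ζ : ℂ) ^ 9 := by
    have hzw : (ζ : ℂ) * w = 1 := by exact_mod_cast hw
    calc (ζ : ℂ) ^ 12 * (w : ℂ) ^ 3 = (ζ : ℂ) ^ 9 * ((ζ : ℂ) * w) ^ 3 := by ring
      _ = (ζ : ℂ) ^ 9 := by rw [hzw]; ring
  by_cases hdet : HF.det = 0
  · have hHC : HC.PosSemidef := by
      have := hD.add (hHFpsd.smul (Complex.zero_le_real.mpr hζ0.le))
      simpa using this
    rw [hHFdet] at hdet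
    calc (ζ : ℂ) ^ 9 * (M3 ψ x y n₀ n₁ n₂ n₃).det ^ 4 = 0 := by rw [hdet, mul_zero]
      _ ≤ HC.det * (w : ℂ) ^ 3 := mul_nonneg hHC.det_nonneg hw3
  · have hPD : HF.PosDef := hHFpsd.posDef_iff_det_ne_zero.mpr hdet
    have hPDζ : ((ζ : ℂ) • HF).PosDef := hPD.smul (Complex.zero_lt_real.mpr hζ0)
    have hle := det_le_det_of_posDef_of_sub_posSemidef hPDζ hD
    rw [det_smul, hHFdet, Fintype.card_prod, Fintype.card_fin, Fintype.card_fin] at hle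
    calc (ζ : ℂ) ^ 9 * (M3 ψ x y n₀ n₁ n₂ n₃).det ^ 4
        = ((ζ : ℂ) ^ (4 * 3) * (M3 ψ x y n₀ n₁ n₂ n₃).det ^ 4) * (w : ℂ) ^ 3 := by rw [← hζw]; ring
      _ ≤ HC.det * (w : ℂ) ^ 3 := mul_le_mul_of_nonneg_right hle hw3

/-- `det BF|_{ζ=1} = det((1 − ψ) + ψP²)⁴ = det(1 + ψU)⁴ ≥ 0` (the Feynman-gauge «three by three determinant to the fourth power», p.372 tl.35).
[cite: MagnenRivasseauSeneor1993, §VI (VI.15) p.372] -/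
theorem det_M3_pow_nonneg (hψ0 : 0 ≤ ψ) (hψ1 : ψ ≤ 1) : (0 : ℂ) ≤ (M3 ψ x y n₀ n₁ n₂ n₃).det ^ 4 :=
  pow_nonneg (M3_posSemidef hψ0 hψ1).det_nonneg 4

/-- **Positivity**: `det BF_cross ≥ 0` (and `> 0` wherever `det(1 + ψU) ≠ 0`, i.e. off the zero set (A.28)) — «a bound showing the strict
positivity of −Δ_B^{homothetic} in a constant field B» (p.382 tl.27–28), for the cross ordering; contrast file 17's `DetSign.det_BFe0_homothetic`
(`det = −50311328125/3 < 0` for the literal ordering of (VI.9) at ζ = 3/13, κ = 1, p = (1,0,0,0), x = y = 2).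
[cite: MagnenRivasseauSeneor1993, App. 1 p.382 tl.26–31, p.383 tl.5–7] -/
theorem det_BF12Cross_nonneg (hζ0 : 0 < ζ) (hζ1 : ζ ≤ 1) (hw : ζ * w = 1) (hψ0 : 0 ≤ ψ) (hψ1 : ψ ≤ 1)
    (h : n₀ ^ 2 + n₁ ^ 2 + n₂ ^ 2 + n₃ ^ 2 = 1) :
    (0 : ℂ) ≤ (BF12Cross ζ w ψ x y n₀ n₁ n₂ n₃).det :=
  (mul_nonneg (pow_nonneg (Complex.zero_le_real.mpr hζ0.le) 9) (det_M3_pow_nonneg hψ0 hψ1)).trans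
    (det_transfer hζ0 hζ1 hw hψ0 hψ1 h)

/-- **p.383 tl.2–7 with the PRINTED constant**: at the homothetic gauge `ζ = 3/13` (p.339 tl.34), `w = 13/3`,
`(3/23)¹² · det BF|_{ζ=1} ≤ det BF_cross` — «bounded up to a factor (3/23)¹² exactly by the same bound as in the Feynman case of ordinary
Laplacians» (indeed `(3/13)⁹ ≥ (3/23)¹²`; the printed `23/13 = 2 − ζ` is (A.27)'s flat upper constant, cf. file 7 `ineq_A27_upper`).
[cite: MagnenRivasseauSeneor1993, App. 1 (A.27) p.382, p.383 tl.1–7] -/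
theorem det_transfer_printed (hψ0 : 0 ≤ ψ) (hψ1 : ψ ≤ 1) (h : n₀ ^ 2 + n₁ ^ 2 + n₂ ^ 2 + n₃ ^ 2 = 1) :
    (((3 / 23 : ℝ) ^ 12 : ℝ) : ℂ) * (M3 ψ x y n₀ n₁ n₂ n₃).det ^ 4 ≤ (BF12Cross (3 / 13) (13 / 3) ψ x y n₀ n₁ n₂ n₃).det := by
  have h1 := det_transfer (x := x) (y := y) (by norm_num : (0 : ℝ) < 3 / 13) (by norm_num)
    (by norm_num : (3 / 13 : ℝ) * (13 / 3) = 1) hψ0 hψ1 h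
  have hc : (((3 / 23 : ℝ) ^ 12 : ℝ) : ℂ) ≤ (((3 / 13 : ℝ) ^ 9 : ℝ) : ℂ) :=
    Complex.real_le_real.mpr (by norm_num)
  have h9 : ((3 / 13 : ℝ) : ℂ) ^ 9 = (((3 / 13 : ℝ) ^ 9 : ℝ) : ℂ) := by push_cast; ring
  rw [h9] at h1
  exact (mul_le_mul_of_nonneg_right hc (det_M3_pow_nonneg hψ0 hψ1)).trans h1

/-- **Logarithmic form (the shape integrated in (VI.14) / Lemma VI.2, «− (1/2) ln(1 + βP(β, κ, t, cos θ, sin φ, ζ, 1/ζ))»)**: where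
`det BF|_{ζ=1} > 0`, `−½ ln det BF_cross ≤ −½ ln det BF|_{ζ=1} + (9/2)·ln(1/ζ)` — the homothetic integrand is bounded by the Feynman one
(whose Lemma VI.2 is PROVED, file 9) plus a constant, pointwise on the sphere (the large-β branch (VI.20a) mechanism; the angular average and
the small-β branch are NOT done here). [cite: MagnenRivasseauSeneor1993, §VI (VI.14) p.372, Lemma VI.2 (VI.20a) p.374; App. 1 p.383 tl.3–7] -/
theorem neg_half_log_det_transfer (hζ0 : 0 < ζ) (hζ1 : ζ ≤ 1) (hw : ζ * w = 1) (hψ0 : 0 ≤ ψ) (hψ1 : ψ ≤ 1)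
    (h : n₀ ^ 2 + n₁ ^ 2 + n₂ ^ 2 + n₃ ^ 2 = 1) (hpos : 0 < ((M3 ψ x y n₀ n₁ n₂ n₃).det ^ 4).re) :
    -(1 / 2) * Real.log ((BF12Cross ζ w ψ x y n₀ n₁ n₂ n₃).det).re ≤
      -(1 / 2) * Real.log ((M3 ψ x y n₀ n₁ n₂ n₃).det ^ 4).re + (9 / 2) * Real.log (1 / ζ) := by
  have hle := det_transfer (x := x) (y := y) hζ0 hζ1 hw hψ0 hψ1 h
  have hre : ζ ^ 9 * ((M3 ψ x y n₀ n₁ n₂ n₃).det ^ 4).re ≤ ((BF12Cross ζ w ψ x y n₀ n₁ n₂ n₃).det).re := by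
    have h1 := (Complex.le_def.1 hle).1
    have h2 : ((ζ : ℂ) ^ 9 * (M3 ψ x y n₀ n₁ n₂ n₃).det ^ 4).re = ζ ^ 9 * ((M3 ψ x y n₀ n₁ n₂ n₃).det ^ 4).re := by
      rw [← Complex.ofReal_pow, Complex.re_ofReal_mul]
    rwa [h2] at h1
  have hpos' : 0 < ζ ^ 9 * ((M3 ψ x y n₀ n₁ n₂ n₃).det ^ 4).re := mul_pos (pow_pos hζ0 9) hpos
  have hlog : Real.log (ζ ^ 9 * ((M3 ψ x y n₀ n₁ n₂ n₃).det ^ 4).re) ≤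
      Real.log ((BF12Cross ζ w ψ x y n₀ n₁ n₂ n₃).det).re := Real.log_le_log hpos' hre
  rw [Real.log_mul (pow_pos hζ0 9).ne' hpos.ne', Real.log_pow] at hlog
  simp only [one_div, Real.log_inv]
  push_cast at hlog
  linarith

end Main

/-! ## §6 (v1.1) The two orderings differ by traceless commutators of degree 2: the first order (VI.17) is common -/

section FirstOrder

variable (ζ w ψ x y n₀ n₁ n₂ n₃ : ℝ)

set_option maxHeartbeats 1600000 in
/-- **CROSS minus LITERAL ordering, every block**: `BFm1Cross_{μν} − BFm1_{μν} = ψ(1 − ζ)·([P_μ, P_ν] + (w − 1)n_ν[P_μ, K_FP])`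
(generalises file 15's `BFm1Cross_sub_BFm1_11`). [cite: MagnenRivasseauSeneor1993, §VI (VI.9) p.370; §IV p.357 tl.15–16] -/
theorem BFm1Cross_sub_BFm1 (μ ν : Fin 4) :
    BFm1Cross ζ w ψ x y n₀ n₁ n₂ n₃ μ ν - BFm1 ζ w ψ x y n₀ n₁ n₂ n₃ μ ν =
      ((ψ * (1 - ζ) : ℝ) : ℂ) • ((Pmat n₀ n₁ n₂ n₃ x y μ * Pmat n₀ n₁ n₂ n₃ x y ν - Pmat n₀ n₁ n₂ n₃ x y ν * Pmat n₀ n₁ n₂ n₃ x y μ)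
        + (((w - 1) * nvec n₀ n₁ n₂ n₃ ν : ℝ) : ℂ) •
          (Pmat n₀ n₁ n₂ n₃ x y μ * KFPUnit n₁ n₂ x y - KFPUnit n₁ n₂ x y * Pmat n₀ n₁ n₂ n₃ x y μ)) := by
  simp only [BFm1Cross, BFm1]
  module

/-- The difference is a sum of commutators, hence TRACELESS in every block: `tr BFm1Cross_{μν} = tr BFm1_{μν}` — so the `tr M` part of
`ln det(1 + M) = tr M − ½tr M² + …` is the same for both orderings. [cite: MagnenRivasseauSeneor1993, §VI (VI.9) p.370, (VI.17) p.373] -/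
theorem trace_BFm1Cross_eq (μ ν : Fin 4) :
    Matrix.trace (BFm1Cross ζ w ψ x y n₀ n₁ n₂ n₃ μ ν) = Matrix.trace (BFm1 ζ w ψ x y n₀ n₁ n₂ n₃ μ ν) := by
  rw [← sub_eq_zero, ← Matrix.trace_sub, BFm1Cross_sub_BFm1, Matrix.trace_smul, Matrix.trace_add, Matrix.trace_smul,
    Matrix.trace_sub, Matrix.trace_sub, Matrix.trace_mul_comm (Pmat n₀ n₁ n₂ n₃ x y μ) (Pmat n₀ n₁ n₂ n₃ x y ν), sub_self,
    Matrix.trace_mul_comm (Pmat n₀ n₁ n₂ n₃ x y μ) (KFPUnit n₁ n₂ x y), sub_self, smul_zero, add_zero, smul_zero]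

set_option maxHeartbeats 1600000 in
/-- The difference is HOMOGENEOUS OF DEGREE 2 in the background `(x, y)` (the commutators `[P_μ, P_ν] = [L_μ, L_ν]`, `[P_μ, K_FP]` involve only
the `x, y`-parts of (VI.6)/(VI.7)): so the two orderings have the same degree-0 and degree-1 parts in `(x, y) ∝ √β` — in particular the same
blocks `R¹` of file 10 — and differ only in the degree-2 (order-β) blocks, by traceless commutators; hence the FIRST ORDER IN β of
`−½ln det BF` (file 10's `lnDetFirstOrder = Σ_μ tr R²_μμ + ½Σ_μν tr(R¹_μν R¹_νμ)`, i.e. (VI.17)) is the same for the cross ordering.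
[cite: MagnenRivasseauSeneor1993, §VI (VI.17) p.373] -/
theorem BFm1Cross_sub_BFm1_homogeneous (s : ℝ) (μ ν : Fin 4) :
    BFm1Cross ζ w ψ (s * x) (s * y) n₀ n₁ n₂ n₃ μ ν - BFm1 ζ w ψ (s * x) (s * y) n₀ n₁ n₂ n₃ μ ν =
      ((s ^ 2 : ℝ) : ℂ) • (BFm1Cross ζ w ψ x y n₀ n₁ n₂ n₃ μ ν - BFm1 ζ w ψ x y n₀ n₁ n₂ n₃ μ ν) := by
  rw [BFm1Cross_sub_BFm1, BFm1Cross_sub_BFm1]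
  ext a b
  fin_cases μ <;> fin_cases ν <;> fin_cases a <;> fin_cases b <;>
    simp [Pmat, KFPUnit, nvec] <;> ring

end FirstOrder


end DetTransfer

end Literature.MathematicalPhysics.QuantumFieldTheory.MagnenRivasseauSeneor1993
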